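import Literature.Analysis.FluidPDE.BilliardTensorDivFree
import HarnessLib

/-!
# Positivity of Serre's billiard tensor (tested form)

Serre's mass–momentum tensor with collitons,
`M = Σ_p (1, v_p) ⊗ (1, v_p) dt|_{γ(p)} + Σ_coll (1/|[v]|) (0, [v]) ⊗ (0, [v]) dℓ`
(Serre 2024 §5 p. 1438; `Literature.Analysis.FluidPDE.BilliardTensorDivFree`), is a sum of
rank-one tensors `u ⊗ u` with nonnegative weights, hence **positive semidefinite** — the second
hypothesis (with `Div`-control) of Compensated Integrability (Serre 2024 Thms. 3, 11). In the
tested language of this block: paired with a space–time field of positive semidefinite quadratic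
forms it is nonnegative. A symmetric `(1 + d) × (1 + d)` form is written in blocks
`Q(s, w) = φ₀₀ s² + 2 s ⟪φ₀, w⟫ + ⟪Φ₁ w, w⟫` (`φ₀₀` scalar, `φ₀` vector, `Φ₁` an operator on `ℝ^d`).

* `quadPairingStreaming φ₀₀ φ₀ Φ₁ t z = Σ_i Q_{(t, x_i)}(1, v_i)` and
  `collitonQuadKernel ε Φ i j pre post = ½ (ε/|Δv_i|) ∫₀¹ ⟪Φ(x_j + proj(s n_{ij})) Δv_i, Δv_i⟫ ds`
  (the colliton only sees the spatial block: its vector is `(0, [v])`);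
  `stQuadPairing ε φ₀₀ φ₀ Φ₁ γ a b = ∫_a^b streaming + Σᶠ collitons` — `⟨M, Q⟩`;
* **`stQuadPairing_nonneg`** — if `Q_{(t,x)} ⪰ 0` pointwise (`0 ≤ φ₀₀ s² + 2s⟪φ₀, w⟫ + ⟪Φ₁ w, w⟫`
  for all `s, w`) and `ε ≥ 0`, then `⟨M, Q⟩ ≥ 0` on every window `a ≤ b` (no regularity needed:
  integrals of nonnegative functions).
* consistency: `collitonQuadKernel ε (Torus.fderiv φ ·)` is `collitonKernel ε φ`
  (`collitonQuadKernel_fderiv`), and the trace pairing of `BilliardTensorTrace` is the case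
  `Q = χ · diag(0, 1)`.

## References

* D. Serre, *Compensated integrability on tori; a priori estimate for space-periodic gas flows*,
  C. R. Math. Acad. Sci. Paris 362 (2024) 1425–1444, §1.1 (positive semi-definiteness), §5. [Serre2024]
-/

open Set Filter Function MeasureTheory
open scoped InnerProductSpace Topology

namespace Literature.Analysis.FluidPDE

noncomputable section

open Literature.Analysis.FunctionSpaces

section Quad

variable {d : Type*} [Fintype d] {N : ℕ}

/-- The particle part of `M` paired with the block quadratic form `Q = (φ₀₀, φ₀, Φ₁)` frozen at
time `t`: `Σ_i (φ₀₀ + 2⟪φ₀, v_i⟫ + ⟪Φ₁ v_i, v_i⟫)(t, x_i) = Σ_i Q(1, v_i)`. [cite: Serre2024, §5 p. 1438] -/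
def quadPairingStreaming (φ₀₀ : ℝ → UnitAddTorus d → ℝ) (φ₀ : ℝ → UnitAddTorus d → EuclideanSpace ℝ d)
    (Φ₁ : ℝ → UnitAddTorus d → EuclideanSpace ℝ d →L[ℝ] EuclideanSpace ℝ d) (t : ℝ)
    (z : Config N d (UnitAddTorus d)) : ℝ :=
  ∑ i, (φ₀₀ t (z i).1 + 2 * ⟪φ₀ t (z i).1, (z i).2⟫_ℝ + ⟪Φ₁ t (z i).1 (z i).2, (z i).2⟫_ℝ)

/-- The colliton of the ordered pair `(i, j)` paired with a field of operators `Φ` on `ℝ^d`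
(the spatial block of the quadratic form; the colliton vector `(0, [v])` has no time component):
`½ (ε/|Δv_i|) ∫₀¹ ⟪Φ(x_j + proj(s n_{ij})) Δv_i, Δv_i⟫ ds`. [cite: Serre2024, §5 p. 1438] -/
def collitonQuadKernel (ε : ℝ) (Φ : UnitAddTorus d → EuclideanSpace ℝ d →L[ℝ] EuclideanSpace ℝ d)
    (i j : Fin N) (pre post : Config N d (UnitAddTorus d)) : ℝ :=
  2⁻¹ * (ε / ‖(post i).2 - (pre i).2‖) *
    ∫ s in (0 : ℝ)..1,
      ⟪Φ ((post j).1 + Torus.proj (s • (Torus.geometry d).sepVec (post i).1 (post j).1))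
        ((post i).2 - (pre i).2), (post i).2 - (pre i).2⟫_ℝ

/-- **`⟨M, Q⟩`**: Serre's tensor with collitons paired with the space–time field of block
quadratic forms `Q = (φ₀₀, φ₀, Φ₁)` over the window (`[a, b]` for the streaming part, collision
times in `(a, b]` for the collitons). [cite: Serre2024, §5 p. 1438] -/
def stQuadPairing (ε : ℝ) (φ₀₀ : ℝ → UnitAddTorus d → ℝ)
    (φ₀ : ℝ → UnitAddTorus d → EuclideanSpace ℝ d)
    (Φ₁ : ℝ → UnitAddTorus d → EuclideanSpace ℝ d →L[ℝ] EuclideanSpace ℝ d)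
    (γ : ℝ → Config N d (UnitAddTorus d)) (a b : ℝ) : ℝ :=
  (∫ s in a..b, quadPairingStreaming φ₀₀ φ₀ Φ₁ s (γ s)) +
    ∑ᶠ t ∈ collisionTimes (Torus.geometry d) ε γ ∩ Ioc a b,
      ∑ p ∈ collidingPairs (Torus.geometry d) ε (γ t),
        collitonQuadKernel ε (Φ₁ t) p.1 p.2 (leftLim γ t) (γ t)

/-- Consistency with the divergence pairing: the colliton kernel of `BilliardTensorDivFree` is the
quadratic colliton kernel of the operator field `Dφ`. [folklore] -/
theorem collitonQuadKernel_fderiv (ε : ℝ) (φ : UnitAddTorus d → EuclideanSpace ℝ d) (i j : Fin N)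
    (pre post : Config N d (UnitAddTorus d)) :
    collitonQuadKernel ε (Torus.fderiv φ) i j pre post = collitonKernel ε φ i j pre post :=
  rfl

/-- A positive semidefinite block form is nonnegative on `(1, v)`. [folklore] -/
theorem quadPairingStreaming_nonneg {φ₀₀ : ℝ → UnitAddTorus d → ℝ}
    {φ₀ : ℝ → UnitAddTorus d → EuclideanSpace ℝ d}
    {Φ₁ : ℝ → UnitAddTorus d → EuclideanSpace ℝ d →L[ℝ] EuclideanSpace ℝ d}
    (hQ : ∀ (t : ℝ) (x : UnitAddTorus d) (s : ℝ) (w : EuclideanSpace ℝ d),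
      0 ≤ φ₀₀ t x * s ^ 2 + 2 * s * ⟪φ₀ t x, w⟫_ℝ + ⟪Φ₁ t x w, w⟫_ℝ)
    (t : ℝ) (z : Config N d (UnitAddTorus d)) : 0 ≤ quadPairingStreaming φ₀₀ φ₀ Φ₁ t z := by
  refine Finset.sum_nonneg fun i _ => ?_
  have h := hQ t (z i).1 1 (z i).2
  simpa using h

/-- A colliton paired with a field of positive semidefinite operators is nonnegative (`ε ≥ 0`).
[folklore] -/
theorem collitonQuadKernel_nonneg {ε : ℝ} (hε : 0 ≤ ε)
    {Φ : UnitAddTorus d → EuclideanSpace ℝ d →L[ℝ] EuclideanSpace ℝ d}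
    (hΦ : ∀ (x : UnitAddTorus d) (w : EuclideanSpace ℝ d), 0 ≤ ⟪Φ x w, w⟫_ℝ) (i j : Fin N)
    (pre post : Config N d (UnitAddTorus d)) : 0 ≤ collitonQuadKernel ε Φ i j pre post := by
  refine mul_nonneg (mul_nonneg (by norm_num) (div_nonneg hε (norm_nonneg _))) ?_
  exact intervalIntegral.integral_nonneg zero_le_one fun s _ => hΦ _ _

/-- **Positivity of `M` (tested).** If the block quadratic form `Q_{(t,x)}(s, w) =
φ₀₀ s² + 2s⟪φ₀, w⟫ + ⟪Φ₁ w, w⟫` is positive semidefinite at every space–time point and `ε ≥ 0`,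
then `⟨M, Q⟩ ≥ 0` on every window `a ≤ b`: the particle part integrates `Σ_p Q(1, v_p) ≥ 0` and
each colliton integrates `⟪Φ₁ [v], [v]⟫ / |[v]| ≥ 0` — `M` is a nonnegative combination of rank-one
tensors `u ⊗ u` (Serre 2024 §1.1, §5). [cite: Serre2024, §1.1 and §5 p. 1438] -/
theorem stQuadPairing_nonneg {ε : ℝ} (hε : 0 ≤ ε) {φ₀₀ : ℝ → UnitAddTorus d → ℝ}
    {φ₀ : ℝ → UnitAddTorus d → EuclideanSpace ℝ d}
    {Φ₁ : ℝ → UnitAddTorus d → EuclideanSpace ℝ d →L[ℝ] EuclideanSpace ℝ d}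
    (hQ : ∀ (t : ℝ) (x : UnitAddTorus d) (s : ℝ) (w : EuclideanSpace ℝ d),
      0 ≤ φ₀₀ t x * s ^ 2 + 2 * s * ⟪φ₀ t x, w⟫_ℝ + ⟪Φ₁ t x w, w⟫_ℝ)
    (γ : ℝ → Config N d (UnitAddTorus d)) {a b : ℝ} (hab : a ≤ b) :
    0 ≤ stQuadPairing ε φ₀₀ φ₀ Φ₁ γ a b := by
  have hΦ : ∀ (t : ℝ) (x : UnitAddTorus d) (w : EuclideanSpace ℝ d), 0 ≤ ⟪Φ₁ t x w, w⟫_ℝ :=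
    fun t x w => by simpa using hQ t x 0 w
  refine add_nonneg (intervalIntegral.integral_nonneg hab fun s _ => quadPairingStreaming_nonneg hQ s (γ s)) ?_
  exact finsum_nonneg fun t => finsum_nonneg fun _ =>
    Finset.sum_nonneg fun p _ => collitonQuadKernel_nonneg hε (hΦ t) p.1 p.2 _ _

end Quad

end

end Literature.Analysis.FluidPDE
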